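import Mathlib.Topology.Closure
import Mathlib.Data.List.Sort
import Mathlib.Data.Finset.Lattice.Fold
import Mathlib.Data.Fintype.Basic
import Mathlib.Order.CompleteLattice.Finset
import Mathlib.Data.List.Pairwise
import HarnessLib

/-!
# Closed-filtration enumeration of finitely many cells that are relatively open in a closed stratification
(Bernstein–Zelevinsky (1976), §1.5: the filtration of an `l`-space with finitely many orbits by closed invariant subsets, successive differences single orbits)

Topic `Topology`; namespace `Literature.Topology`.  THEOREMS ONLY (no def, no instance, no named fact, no `sorry`); pure point-set bookkeeping, Mathlib only.

SETTING.  A topological space `X`, a finite index set `S : Finset ι` of CELLS `A i ⊆ X` with RANKS `rk i : ℕ`, and a CLOSED FILTRATION `W : ℕ → Set X` (`W 0 = ∅`,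
monotone, each `W k` closed) such that: every cell of rank `r` lies in the stratum `W (r+1) ∖ W r` (`hA`); every point of the stratum `W (k+1) ∖ W k` lies in a
cell of rank `k` (`hcov`); every cell is cut out INSIDE ITS STRATUM by an open set (`hopen`); distinct cells are disjoint (`hdisj`).  (Model: `X = G` a `p`-adic group,
cells = the finitely many unipotent conjugacy classes, `W k = {(γ − 1)^k = 0}`.)
* `closure_cell_subset` — each cell is closed in its stratum: `closure (A i) ⊆ A i ∪ W (rk i)`;
* `isClosed_biUnion_of_rank_downward` — a rank-downward-closed subfamily has closed union;
* `exists_enum_forall_isClosed_iUnion_lt` — **the closed-filtration enumeration**: `∃ n (e : Fin n → ι), (∀ i, i ∈ S ↔ ∃ j, e j = i) ∧ ∀ k, IsClosed (⋃ j, ⋃ (_ : j.val < k), A (e j))`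
  (sort `S` by rank).
This is the hypothesis `hfilt` of the orbital-integral kernel decomposition (Howe ∕ Harish-Chandra span property) in the tree's generic form.

## References
* [BernsteinZelevinsky1976] I. N. Bernstein, A. V. Zelevinsky, *Representations of the group GL(n, F) where F is a non-archimedean local field*, Russian Math.
  Surveys 31:3 (1976) 1–68, §1.5 (actions with finitely many orbits; the filtration by closed invariant subsets).
-/

namespace Literature.Topology

section Filtration

variable {X ι : Type*} [TopologicalSpace X] (S : Finset ι) (A : ι → Set X) (rk : ι → ℕ) (W : ℕ → Set X)

/-- **Relative closedness of a cell in its stratum**: if the stratum `W (rk i + 1) ∖ W (rk i)` is covered by finitely many pairwise disjoint cells of `S`, each cut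
out inside the stratum by an OPEN set, then `closure (A i) ⊆ A i ∪ W (rk i)` — a cell is closed in its stratum (the finitely-many-orbits bookkeeping of
Bernstein–Zelevinsky's stratification §1.5). [cite: BernsteinZelevinsky1976, §1.5] -/
theorem closure_cell_subset
    (hWc : ∀ k, IsClosed (W k))
    (hA : ∀ i ∈ S, A i ⊆ W (rk i + 1) ∧ Disjoint (A i) (W (rk i)))
    (hcov : ∀ (k : ℕ) (x : X), x ∈ W (k + 1) → x ∉ W k → ∃ i ∈ S, rk i = k ∧ x ∈ A i)
    (hopen : ∀ i ∈ S, ∃ V : Set X, IsOpen V ∧ ∀ x, x ∈ W (rk i + 1) → x ∉ W (rk i) → (x ∈ V ↔ x ∈ A i))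
    (hdisj : ∀ i ∈ S, ∀ i' ∈ S, i ≠ i' → Disjoint (A i) (A i'))
    {i : ι} (hi : i ∈ S) : closure (A i) ⊆ A i ∪ W (rk i) := by
  intro y hy
  have hyW : y ∈ W (rk i + 1) := (hWc _).closure_subset_iff.2 (hA i hi).1 hy
  by_cases hyk : y ∈ W (rk i)
  · exact Or.inr hyk
  obtain ⟨i', hi'S, hrk, hyi'⟩ := hcov (rk i) y hyW hyk
  by_cases hii' : i = i'
  · subst hii'; exact Or.inl hyi'
  obtain ⟨V', hV'o, hV'⟩ := hopen i' hi'S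
  have hyV' : y ∈ V' := (hV' y (hrk ▸ hyW) (hrk ▸ hyk)).2 hyi'
  obtain ⟨z, hzV', hzA⟩ := mem_closure_iff.1 hy V' hV'o hyV'
  have hzW : z ∈ W (rk i' + 1) := hrk ▸ (hA i hi).1 hzA
  have hzk : z ∉ W (rk i') := fun h => Set.disjoint_left.1 (hA i hi).2 hzA (hrk ▸ h)
  exact absurd hzA (Set.disjoint_right.1 (hdisj i hi i' hi'S hii') ((hV' z hzW hzk).1 hzV'))

/-- **A rank-downward-closed subfamily has CLOSED union**: with `W 0 = ∅`, `W` monotone and closed, strata covered by the cells of that rank, cells relatively open in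
their stratum and pairwise disjoint, every `T ⊆ S` closed under «`rk i' < rk i`, `i ∈ T` ⇒ `i' ∈ T`» has `⋃_{i ∈ T} A i` closed (it is `W ℓ ∪ ⋃_{rk = ℓ} A i`,
`ℓ = max rk`). [cite: BernsteinZelevinsky1976, §1.5] -/
theorem isClosed_biUnion_of_rank_downward
    (hW0 : W 0 = ∅) (hWmono : Monotone W) (hWc : ∀ k, IsClosed (W k))
    (hA : ∀ i ∈ S, A i ⊆ W (rk i + 1) ∧ Disjoint (A i) (W (rk i)))
    (hcov : ∀ (k : ℕ) (x : X), x ∈ W (k + 1) → x ∉ W k → ∃ i ∈ S, rk i = k ∧ x ∈ A i)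
    (hopen : ∀ i ∈ S, ∃ V : Set X, IsOpen V ∧ ∀ x, x ∈ W (rk i + 1) → x ∉ W (rk i) → (x ∈ V ↔ x ∈ A i))
    (hdisj : ∀ i ∈ S, ∀ i' ∈ S, i ≠ i' → Disjoint (A i) (A i'))
    (T : Finset ι) (hTS : T ⊆ S) (hdown : ∀ i ∈ T, ∀ i' ∈ S, rk i' < rk i → i' ∈ T) :
    IsClosed (⋃ i ∈ T, A i) := by
  rcases T.eq_empty_or_nonempty with hT | hT
  · simp [hT]
  obtain ⟨i₀, hi₀, hℓ⟩ := Finset.exists_mem_eq_sup' hT rk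
  set ℓ := T.sup' hT rk with hℓdef
  -- `W ℓ ⊆ ⋃ T`
  have hWℓ : W ℓ ⊆ ⋃ i ∈ T, A i := by
    intro x hx
    classical
    have hex : ∃ m, x ∈ W m := ⟨ℓ, hx⟩
    have hm0 : Nat.find hex ≠ 0 := fun h0 => by
      have hxm : x ∈ W (Nat.find hex) := Nat.find_spec hex
      rw [h0, hW0] at hxm
      exact hxm
    obtain ⟨m', hm'⟩ := Nat.exists_eq_succ_of_ne_zero hm0
    have hxm : x ∈ W (m' + 1) := by
      have h := Nat.find_spec hex
      rw [hm'] at h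
      exact h
    have hxm' : x ∉ W m' := Nat.find_min hex (by rw [hm']; exact Nat.lt_succ_self m')
    have hmℓ : m' + 1 ≤ ℓ := by
      have h := Nat.find_le (h := hex) hx
      rw [hm'] at h
      exact h
    obtain ⟨i, hiS, hrki, hxi⟩ := hcov m' x hxm hxm'
    have hiT : i ∈ T := hdown i₀ hi₀ i hiS (by rw [hrki, ← hℓ]; omega)
    exact Set.mem_biUnion hiT hxi
  rw [← closure_subset_iff_isClosed, Finset.closure_biUnion]
  intro y hy
  obtain ⟨i, hiT, hyi⟩ := Set.mem_iUnion₂.1 hy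
  rcases closure_cell_subset S A rk W hWc hA hcov hopen hdisj (hTS hiT) hyi with h | h
  · exact Set.mem_biUnion hiT h
  · exact hWℓ (hWmono (Finset.le_sup' rk hiT) h)

/-- **Closed-filtration enumeration** (the shape consumed by orbital-integral kernel decompositions): sorting `S` by rank gives `e : Fin n → ι` enumerating `S`
(`i ∈ S ↔ ∃ j, e j = i`) all of whose initial segments `⋃_{j < k} A (e j)` are CLOSED — Bernstein–Zelevinsky's filtration `∅ = Z₀ ⊆ Z₁ ⊆ ⋯ ⊆ Z_n` of a space with
finitely many orbits by closed invariant subsets with one orbit in each successive difference, in elementary form. [cite: BernsteinZelevinsky1976, §1.5] -/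
theorem exists_enum_forall_isClosed_iUnion_lt
    (hW0 : W 0 = ∅) (hWmono : Monotone W) (hWc : ∀ k, IsClosed (W k))
    (hA : ∀ i ∈ S, A i ⊆ W (rk i + 1) ∧ Disjoint (A i) (W (rk i)))
    (hcov : ∀ (k : ℕ) (x : X), x ∈ W (k + 1) → x ∉ W k → ∃ i ∈ S, rk i = k ∧ x ∈ A i)
    (hopen : ∀ i ∈ S, ∃ V : Set X, IsOpen V ∧ ∀ x, x ∈ W (rk i + 1) → x ∉ W (rk i) → (x ∈ V ↔ x ∈ A i))
    (hdisj : ∀ i ∈ S, ∀ i' ∈ S, i ≠ i' → Disjoint (A i) (A i')) :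
    ∃ (n : ℕ) (e : Fin n → ι), (∀ i, i ∈ S ↔ ∃ j, e j = i) ∧ ∀ k : ℕ, IsClosed (⋃ (j : Fin n) (_ : j.val < k), A (e j)) := by
  classical
  let r : ι → ι → Prop := fun a b => rk a ≤ rk b
  haveI : Std.Total r := ⟨fun a b => le_total (rk a) (rk b)⟩
  haveI : IsTrans ι r := ⟨fun a b c hab hbc => le_trans hab hbc⟩
  set l : List ι := (S.toList).insertionSort r with hl
  have hperm : l.Perm S.toList := List.perm_insertionSort r _
  have hsorted : l.Pairwise r := List.pairwise_insertionSort r _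
  have hmem : ∀ i, i ∈ S ↔ i ∈ l := fun i => by rw [hperm.mem_iff, Finset.mem_toList]
  refine ⟨l.length, fun j => l.get j, fun i => ?_, fun k => ?_⟩
  · rw [hmem, List.mem_iff_get]
  · have hset : (⋃ (j : Fin l.length) (_ : j.val < k), A (l.get j)) =
        ⋃ i ∈ (Finset.univ.filter fun j : Fin l.length => j.val < k).image (fun j => l.get j), A i := by
      rw [Finset.set_biUnion_finset_image]
      apply Set.iUnion_congr fun j => ?_
      simp only [Finset.mem_filter, Finset.mem_univ, true_and]
    rw [hset]
    refine isClosed_biUnion_of_rank_downward S A rk W hW0 hWmono hWc hA hcov hopen hdisj _ (fun i hi => ?_) (fun i hi i' hi'S hlt => ?_)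
    · obtain ⟨j, -, rfl⟩ := Finset.mem_image.1 hi
      exact (hmem _).2 (List.get_mem l j)
    · obtain ⟨j, hj, rfl⟩ := Finset.mem_image.1 hi
      have hjk : j.val < k := by simpa using hj
      obtain ⟨j', hj'⟩ := List.mem_iff_get.1 ((hmem i').1 hi'S)
      refine Finset.mem_image.2 ⟨j', ?_, hj'⟩
      have hj'j : j' < j := by
        by_contra hle
        rcases (not_lt.1 hle).lt_or_eq with hlt' | heq
        · have h1 : r (l.get j) (l.get j') := hsorted.rel_get_of_lt hlt'
          have h2 : rk (l.get j) ≤ rk i' := by simpa only [r, hj'] using h1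
          exact absurd hlt (not_lt.2 h2)
        · have h3 : l.get j = i' := by rw [heq, hj']
          rw [h3] at hlt
          exact lt_irrefl _ hlt
      simpa using lt_trans (Fin.lt_def.1 hj'j) hjk

end Filtration

end Literature.Topology
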